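import Mathlib
import HarnessLib

/-!
# The walk: finite induction along a `√s`-uniform mesh (crux `NudgeRemoval`, stub C)

Crux `BECNudgeWalk.NudgeRemoval` (stmt-AtomisticToContinuum-14361), line `registered`, stub C
`stub_walkInduction`: the purely real-analytic induction ("the walk") of the fixed-`N` perturbation
argument. Read `P t β` as "at reward `t` the near-minimisers are condensed at level `β`" (smaller `β` is
better). Hypotheses: levels may be worsened (monotonicity); from reward `s ≤ s₁` at a level `β ∈ [0, η)`
one may step down to any `t ∈ (0, s]` with `s - t ≤ κ√s`, paying `M(s - t)/√s` plus an arbitrary slack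
`σ > 0`; level `b` holds at the top reward `s₁`; and the budget `b + 2M√s₁ < b' < η`. Conclusion: level
`b'` at every `t ∈ (0, s₁]`.

Proof. With room `R = b' - b - 2M√s₁ > 0` refine the mesh to `κ' = min κ (R / (3(M+1)))` (so
`Mκ' ≤ R/3`), walk along the mesh `√s₁ - kκ'/2` (uniform in `√s`), and pay the slack
`σ = κ' R / (3(2√s₁ + κ'))` per step. The claim `∀ k t, 0 < t ≤ s₁ → √s₁ - kκ'/2 ≤ √t → P t (b + k(Mκ' + σ))`
is proved by induction on `k`: for the step one moves from `s = min s₁ (√t + κ'/2)²` (where the claim for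
`k` applies) down to `t`, with `s - t = (√s - √t)(√s + √t) ≤ κ'√s` and cost `≤ Mκ' + σ`; the levels stay
below `b + 2M√s₁ + 2R/3 < b' < η` as long as a genuine step is needed (`kκ'/2 < √s₁`). Finally
`k = ⌈2√s₁/κ'⌉₊` steps reach every `t ∈ (0, s₁]` at level `≤ b'`.

Mathlib only; no named facts.
-/

noncomputable section

namespace Summit.AtomisticToContinuum.BoseEinsteinCondensation.Cruxes.NudgeRemoval.Registered

/-- **Parameters of the walk.** Given the mesh bound `κ > 0`, the cost rate `M ≥ 0`, the room `R > 0`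
and `A = √s₁ > 0`, there are a refined mesh `0 < κ' ≤ κ`, a slack `σ > 0` and a number of steps `n`
with `2A ≤ nκ' ≤ 2A + κ'`, such that every `x` with `xκ' ≤ 2A + κ'` has total cost
`x(Mκ' + σ) ≤ 2MA + R`. (Take `κ' = min κ (R/(3(M+1)))`, `σ = κ' R/(3(2A + κ'))`, `n = ⌈2A/κ'⌉₊`.) -/
private theorem walk_parameters {κ M R A : ℝ} (hκ : 0 < κ) (hM : 0 ≤ M) (hR : 0 < R) (hA : 0 < A) :
    ∃ κ' σ : ℝ, ∃ n : ℕ, 0 < κ' ∧ κ' ≤ κ ∧ 0 < σ ∧ 2 * A ≤ n * κ' ∧ (n : ℝ) * κ' ≤ 2 * A + κ' ∧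
      ∀ x : ℝ, x * κ' ≤ 2 * A + κ' → x * (M * κ' + σ) ≤ 2 * M * A + R := by
  obtain ⟨κ', hκ'⟩ : ∃ κ' : ℝ, κ' = min κ (R / (3 * (M + 1))) := ⟨_, rfl⟩
  have hM1 : 0 < M + 1 := by linarith
  have hκ'0 : 0 < κ' := hκ' ▸ lt_min hκ (by positivity)
  have hκ'κ : κ' ≤ κ := hκ' ▸ min_le_left _ _
  have hMκ' : 3 * (M * κ') ≤ R := by
    have h1 : κ' ≤ R / (3 * (M + 1)) := hκ' ▸ min_le_right _ _
    have h2 : M * κ' ≤ (M + 1) * κ' := by nlinarith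
    have h3 : (M + 1) * κ' ≤ (M + 1) * (R / (3 * (M + 1))) :=
      mul_le_mul_of_nonneg_left h1 hM1.le
    have h4 : (M + 1) * (R / (3 * (M + 1))) = R / 3 := by
      field_simp
    linarith
  have hB : 0 < 2 * A + κ' := by positivity
  obtain ⟨σ, hσ⟩ : ∃ σ : ℝ, σ = κ' * (R / (3 * (2 * A + κ'))) := ⟨_, rfl⟩
  have hσ0 : 0 < σ := hσ ▸ by positivity
  refine ⟨κ', σ, ⌈2 * A / κ'⌉₊, hκ'0, hκ'κ, hσ0, ?_, ?_, ?_⟩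
  · have h := Nat.le_ceil (2 * A / κ')
    rwa [div_le_iff₀ hκ'0] at h
  · have h := Nat.ceil_lt_add_one (show (0 : ℝ) ≤ 2 * A / κ' by positivity)
    have h' : (⌈2 * A / κ'⌉₊ : ℝ) * κ' ≤ (2 * A / κ' + 1) * κ' :=
      mul_le_mul_of_nonneg_right h.le hκ'0.le
    have h'' : (2 * A / κ' + 1) * κ' = 2 * A + κ' := by
      field_simp
    linarith
  · intro x hx
    have h1 : M * (x * κ') ≤ M * (2 * A + κ') := mul_le_mul_of_nonneg_left hx hM
    have h2 : x * κ' * (R / (3 * (2 * A + κ'))) ≤ (2 * A + κ') * (R / (3 * (2 * A + κ'))) :=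
      mul_le_mul_of_nonneg_right hx (by positivity)
    have h3 : (2 * A + κ') * (R / (3 * (2 * A + κ'))) = R / 3 := by
      field_simp
    calc x * (M * κ' + σ) = M * (x * κ') + x * κ' * (R / (3 * (2 * A + κ'))) := by rw [hσ]; ring
      _ ≤ M * (2 * A + κ') + R / 3 := by linarith
      _ ≤ 2 * M * A + R := by linarith

/-- **One mesh step.** If `0 < t ≤ s₁`, `c - κ'/2 ≤ √t` and `c ≤ √s₁`, then `s = min s₁ (√t + κ'/2)²`
satisfies `t ≤ s ≤ s₁`, `c ≤ √s` and `s - t ≤ κ'√s` (since `√s - √t ≤ κ'/2` and `√s + √t ≤ 2√s`). -/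
private theorem walk_mesh_step {s₁ t κ' c : ℝ} (ht : 0 < t) (hts₁ : t ≤ s₁) (hκ' : 0 < κ')
    (hc : c - κ' / 2 ≤ Real.sqrt t) (hcs₁ : c ≤ Real.sqrt s₁) :
    ∃ s, t ≤ s ∧ s ≤ s₁ ∧ c ≤ Real.sqrt s ∧ s - t ≤ κ' * Real.sqrt s := by
  have ht0 : 0 ≤ Real.sqrt t := Real.sqrt_nonneg t
  have hu : 0 ≤ Real.sqrt t + κ' / 2 := by positivity
  have htt : Real.sqrt t ^ 2 = t := Real.sq_sqrt ht.le
  have htu : t ≤ (Real.sqrt t + κ' / 2) ^ 2 := by nlinarith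
  refine ⟨min s₁ ((Real.sqrt t + κ' / 2) ^ 2), le_min hts₁ htu, min_le_left _ _, ?_, ?_⟩
  · rcases min_choice s₁ ((Real.sqrt t + κ' / 2) ^ 2) with h | h <;> rw [h]
    · exact hcs₁
    · rw [Real.sqrt_sq hu]
      linarith
  · set s := min s₁ ((Real.sqrt t + κ' / 2) ^ 2)
    have hs0 : 0 ≤ s := le_trans ht.le (le_min hts₁ htu)
    have hss : Real.sqrt s ^ 2 = s := Real.sq_sqrt hs0
    have hsu : Real.sqrt s ≤ Real.sqrt t + κ' / 2 :=
      calc Real.sqrt s ≤ Real.sqrt ((Real.sqrt t + κ' / 2) ^ 2) :=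
            Real.sqrt_le_sqrt (min_le_right _ _)
        _ = Real.sqrt t + κ' / 2 := Real.sqrt_sq hu
    have hts : Real.sqrt t ≤ Real.sqrt s := Real.sqrt_le_sqrt (le_min hts₁ htu)
    nlinarith [mul_nonneg (sub_nonneg.2 hsu) (add_nonneg (Real.sqrt_nonneg s) ht0),
      mul_le_mul_of_nonneg_left hts hκ'.le]

/-- **The walk** (stub C of crux `NudgeRemoval`). For an abstract predicate `P : ℝ → ℝ → Prop`
("condensed at level `β` at reward `t`") that is monotone in the level and admits the one-step estimate
`P s β → P t (β + M(s - t)/√s + σ)` for `0 < t ≤ s ≤ s₁`, `s - t ≤ κ√s`, `0 ≤ β < η`, `σ > 0`, the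
initial level `b` at `s₁` propagates to level `b'` at every `t ∈ (0, s₁]` as soon as
`b + 2M√s₁ < b' < η` (the costs along a `√s`-uniform mesh form a Riemann sum of `∫₀^{s₁} M ds/√s = 2M√s₁`). -/
theorem stub_walkInduction : ∀ (P : ℝ → ℝ → Prop) (s₁ κ M η b b' : ℝ),
    0 < s₁ → 0 < κ → 0 ≤ M → 0 ≤ b → b + 2 * M * Real.sqrt s₁ < b' → b' < η →
    (∀ t β β', P t β → β ≤ β' → P t β') →
    (∀ s β σ t, 0 < s → s ≤ s₁ → 0 ≤ β → β < η → P s β → 0 < σ → 0 < t → t ≤ s →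
        s - t ≤ κ * Real.sqrt s → P t (β + M * (s - t) / Real.sqrt s + σ)) →
    P s₁ b → ∀ t, 0 < t → t ≤ s₁ → P t b' := by
  intro P s₁ κ M η b b' hs₁ hκ hM hb hbud hb'η hmono hstep hinit
  have hA : 0 < Real.sqrt s₁ := Real.sqrt_pos.2 hs₁
  obtain ⟨κ', σ, n, hκ'0, hκ'κ, hσ0, hn, hn', hlev⟩ :=
    walk_parameters (A := Real.sqrt s₁) (R := b' - b - 2 * M * Real.sqrt s₁) hκ hM (by linarith) hA
  -- the claim, by induction on the number `k` of mesh steps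
  have claim : ∀ k : ℕ, ∀ t, 0 < t → t ≤ s₁ →
      Real.sqrt s₁ - k * κ' / 2 ≤ Real.sqrt t → P t (b + k * (M * κ' + σ)) := by
    intro k
    induction k with
    | zero =>
      intro t ht hts h
      have h' : Real.sqrt s₁ ≤ Real.sqrt t := by simpa using h
      have hst : s₁ ≤ t := (Real.sqrt_le_sqrt_iff ht.le).1 h'
      have hteq : t = s₁ := le_antisymm hts hst
      subst hteq
      simpa using hinit
    | succ k ih =>
      intro t ht hts h
      push_cast at h ⊢
      rcases le_or_gt (Real.sqrt s₁ - k * κ' / 2) (Real.sqrt t) with hle | hlt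
      · -- no genuine step needed: the claim for `k` and monotonicity
        have hL : 0 ≤ M * κ' + σ := by positivity
        exact hmono t _ _ (ih t ht hts hle) (by nlinarith)
      · -- a genuine step from `s = min s₁ (√t + κ'/2)²` down to `t`
        have hc : Real.sqrt s₁ - k * κ' / 2 - κ' / 2 ≤ Real.sqrt t := by linarith
        have hk0 : (0 : ℝ) ≤ k * κ' / 2 := by positivity
        have hcs₁ : Real.sqrt s₁ - k * κ' / 2 ≤ Real.sqrt s₁ := by linarith
        obtain ⟨s, hts', hss₁, hcs, hst⟩ := walk_mesh_step ht hts hκ'0 hc hcs₁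
        have hs : 0 < s := lt_of_lt_of_le ht hts'
        have hsq : 0 < Real.sqrt s := Real.sqrt_pos.2 hs
        have hk : (k : ℝ) * κ' ≤ 2 * Real.sqrt s₁ + κ' := by
          linarith [Real.sqrt_nonneg t]
        have hβη : b + k * (M * κ' + σ) < η := by
          have := hlev k hk
          linarith
        have hβ0 : 0 ≤ b + k * (M * κ' + σ) := by positivity
        have hP := hstep s _ σ t hs hss₁ hβ0 hβη (ih s hs hss₁ hcs) hσ0 ht hts'
          (le_trans hst (mul_le_mul_of_nonneg_right hκ'κ (Real.sqrt_nonneg s)))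
        refine hmono t _ _ hP ?_
        have hdiv : M * (s - t) / Real.sqrt s ≤ M * κ' := by
          rw [div_le_iff₀ hsq]
          calc M * (s - t) ≤ M * (κ' * Real.sqrt s) := mul_le_mul_of_nonneg_left hst hM
            _ = M * κ' * Real.sqrt s := by ring
        linarith
  -- conclusion: `n = ⌈2√s₁/κ'⌉₊` steps reach every `t ∈ (0, s₁]`, at level `≤ b'`
  intro t ht hts
  have h1 : Real.sqrt s₁ - n * κ' / 2 ≤ Real.sqrt t := by
    linarith [Real.sqrt_nonneg t]
  refine hmono t _ _ (claim n t ht hts h1) ?_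
  have := hlev n hn'
  linarith

end Summit.AtomisticToContinuum.BoseEinsteinCondensation.Cruxes.NudgeRemoval.Registered

end
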